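/-
Copyright (c) 2026. All rights reserved.
Released under Apache 2.0 license as described in the file LICENSE.
Authors: abc-iut cell, prover seat abc-iut-w5-d017 (wave 5, gen 5).
-/
import Literature.IUT.LogVolume.UnitLogWildPrime
import HarnessLib

/-!
# The dominant term of the `p`-adic logarithmic series over a discrete value group

Proof-only toolkit (theorems, no definitions) for EXACT norm computations of the logarithmic series
`L(y) = −Σ_{n ≥ 1} (1−y)ⁿ/n` of abc-iut-S1's `LocalUnitLog.lean` on a principal unit `y` of a
mixed-characteristic local field `K` (normed `ℚ_p`-algebra, ultrametric, proper), in terms of the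
DISCRETE value group `‖K^×‖ = ‖ϖ‖^ℤ` of a norm uniformizer `ϖ` (`RamificationInvariants.lean`:
`‖p‖ = ‖ϖ‖^e`, `e = absRamificationIdx p K`).  Consumer: `UnitLogRamificationCriterion.lean` (when is
`log_p u` a unit?), which replaces the case-by-case estimates of `UnitLogWildPrime.lean`,
`UnitLogWildQuartic.lean`, `WildCubicUnitLogUnit.lean`.

Write `‖1 − y‖ = ‖ϖ‖^s` (`s ≥ 1`).  The term of index `n` has norm `‖ϖ‖^{N(n)}` with the INTEGER
exponent `N(n) = s·n − e·v_p(n)` (`norm_logTerm_eq_zpow`).  For `n = p^a·m`, `p ∤ m`,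
`N(n) = h(a) + s·p^a·(m−1)` with `h(a) = s·p^a − e·a` (`exists_exponent_le_index`: non-prime-power
indices are never minimal, and exceed `h(a)` by `≥ 1`).  Along `a`, the increments
`h(a+1) − h(a) = s·p^a·(p−1) − e` grow (`increment_mono`), so with `a₀` the first index with
`e ≤ s·p^{a₀}·(p−1)` ("turning point", it exists: `exists_le_increment`) the sequence `h` strictly
decreases up to `a₀` and does not decrease afterwards: `h(a₀) = min h` (`exponent_min`), and if the
turning inequality is STRICT the minimiser is unique with an integer gap, `h(a) ≥ h(a₀) + 1` for
`a ≠ a₀` (`exponent_min_strict`).  Finally two ultrametric read-outs: if every exponent is `≥ 1` then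
`‖L(y)‖ ≤ ‖ϖ‖ < 1` (`norm_logSeries_le_norm_unif`), and if one term has exponent `N₀` while all others
have exponent `≥ N₀ + 1` then `‖L(y)‖ = ‖ϖ‖^{N₀}` EXACTLY (`norm_logSeries_eq_zpow_of_dominant`, the
isosceles principle applied to the convergent series).

Classical (Neukirch, *Algebraic Number Theory*, Ch. II (5.5); Koblitz GTM 58 Ch. IV §1).  Nothing here is
disputed mathematics; no IUT statement is asserted; nothing bears on [IUTchIII] Cor. 3.12.
-/

noncomputable section

open Metric Set

namespace Literature.IUT.LogVolume

namespace RamificationCriterion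

open Literature.NumberTheory.GaloisRepresentations.Ultrametric

/-! ### §1. Arithmetic of the exponents `h(a) = S·P^a − E·a` -/

section Exponents

variable {S P E : ℤ} {a₀ : ℕ}

/-- The increment `h(a+1) − h(a) = S·P^a·(P − 1) − E`. [cite: NeukirchANT1999, Ch. II (5.5)] -/
theorem exponent_succ_sub (S P E : ℤ) (a : ℕ) :
    (S * P ^ (a + 1) - E * ((a + 1 : ℕ) : ℤ)) - (S * P ^ a - E * (a : ℤ))
      = S * P ^ a * (P - 1) - E := by
  push_cast
  ring

/-- The increments are monotone in `a` (`P ≥ 2`, `S ≥ 1`). [cite: NeukirchANT1999, Ch. II (5.5)] -/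
theorem increment_mono (hS : 1 ≤ S) (hP : 2 ≤ P) {a b : ℕ} (hab : a ≤ b) :
    S * P ^ a * (P - 1) ≤ S * P ^ b * (P - 1) := by
  have hPa : P ^ a ≤ P ^ b := pow_le_pow_right₀ (by linarith) hab
  have h1 : 0 ≤ S * (P - 1) := by nlinarith
  nlinarith

/-- Below the turning point the exponents strictly DECREASE: if `S·P^a·(P−1) < E` for all `a < a₀`
then `h(a₀) + d ≤ h(a)` whenever `a + d = a₀`. [cite: NeukirchANT1999, Ch. II (5.5)] -/
theorem exponent_add_le (hlo : ∀ a < a₀, S * P ^ a * (P - 1) < E) :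
    ∀ (d a : ℕ), a + d = a₀ → (S * P ^ a₀ - E * (a₀ : ℤ)) + d ≤ S * P ^ a - E * (a : ℤ) := by
  intro d
  induction d with
  | zero =>
    intro a ha
    subst ha
    simp
  | succ d ih =>
    intro a ha
    have ih' := ih (a + 1) (by omega)
    have hstep := hlo a (by omega)
    have hid := exponent_succ_sub S P E a
    push_cast at ih' hid ⊢
    linarith

/-- Above the turning point the exponents do not decrease: if `E ≤ S·P^{a₀}·(P−1)` then
`h(a₀ + d) ≤ h(a₀ + d + 1)`. [cite: NeukirchANT1999, Ch. II (5.5)] -/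
theorem exponent_step_nonneg (hS : 1 ≤ S) (hP : 2 ≤ P) (hhi : E ≤ S * P ^ a₀ * (P - 1)) (d : ℕ) :
    S * P ^ (a₀ + d) - E * ((a₀ + d : ℕ) : ℤ)
      ≤ S * P ^ (a₀ + d + 1) - E * ((a₀ + d + 1 : ℕ) : ℤ) := by
  have hid := exponent_succ_sub S P E (a₀ + d)
  have hmono := increment_mono hS hP (Nat.le_add_right a₀ d)
  push_cast at hid hmono ⊢
  linarith

/-- All later exponents dominate `h(a₀ + 1)`: `h(a₀ + 1) ≤ h(a₀ + 1 + d)`.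
[cite: NeukirchANT1999, Ch. II (5.5)] -/
theorem exponent_succ_le_add (hS : 1 ≤ S) (hP : 2 ≤ P) (hhi : E ≤ S * P ^ a₀ * (P - 1)) :
    ∀ d : ℕ, S * P ^ (a₀ + 1) - E * ((a₀ + 1 : ℕ) : ℤ)
      ≤ S * P ^ (a₀ + d + 1) - E * ((a₀ + d + 1 : ℕ) : ℤ) := by
  intro d
  induction d with
  | zero => simp
  | succ d ih =>
    have hs := exponent_step_nonneg hS hP hhi (d + 1)
    rw [show a₀ + (d + 1) = a₀ + d + 1 from rfl] at hs
    exact ih.trans hs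

/-- **The minimum.** With `a₀` the turning point (`S·P^a·(P−1) < E` for `a < a₀`,
`E ≤ S·P^{a₀}·(P−1)`): `h(a₀) ≤ h(a)` for every `a`. [cite: NeukirchANT1999, Ch. II (5.5)] -/
theorem exponent_min (hS : 1 ≤ S) (hP : 2 ≤ P)
    (hlo : ∀ a < a₀, S * P ^ a * (P - 1) < E) (hhi : E ≤ S * P ^ a₀ * (P - 1)) (a : ℕ) :
    S * P ^ a₀ - E * (a₀ : ℤ) ≤ S * P ^ a - E * (a : ℤ) := by
  rcases le_or_gt a a₀ with ha | ha
  · obtain ⟨d, rfl⟩ := Nat.exists_eq_add_of_le ha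
    have h := exponent_add_le hlo d a rfl
    have h0 : (0 : ℤ) ≤ (d : ℤ) := by positivity
    linarith
  · obtain ⟨d, rfl⟩ := Nat.exists_eq_add_of_lt ha
    have hfirst := exponent_step_nonneg hS hP hhi 0
    simp only [add_zero] at hfirst
    have hrest := exponent_succ_le_add hS hP hhi d
    exact hfirst.trans hrest

/-- **Strict minimum.** If moreover `E < S·P^{a₀}·(P−1)` (no tie with `a₀ + 1`), then
`h(a₀) + 1 ≤ h(a)` for every `a ≠ a₀`: the minimiser is UNIQUE with an integer gap.
[cite: NeukirchANT1999, Ch. II (5.5)] -/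
theorem exponent_min_strict (hS : 1 ≤ S) (hP : 2 ≤ P)
    (hlo : ∀ a < a₀, S * P ^ a * (P - 1) < E) (hhi : E < S * P ^ a₀ * (P - 1)) {a : ℕ}
    (ha : a ≠ a₀) : S * P ^ a₀ - E * (a₀ : ℤ) + 1 ≤ S * P ^ a - E * (a : ℤ) := by
  rcases lt_or_gt_of_ne ha with ha | ha
  · obtain ⟨d, rfl⟩ := Nat.exists_eq_add_of_lt ha
    have h := exponent_add_le hlo (d + 1) a rfl
    push_cast at h ⊢
    linarith
  · obtain ⟨d, rfl⟩ := Nat.exists_eq_add_of_lt ha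
    -- the first step is strict by `hhi`, then non-decreasing
    have hfirst : S * P ^ a₀ - E * (a₀ : ℤ) + 1 ≤ S * P ^ (a₀ + 1) - E * ((a₀ + 1 : ℕ) : ℤ) := by
      have hid := exponent_succ_sub S P E a₀
      push_cast at hid ⊢
      linarith
    exact hfirst.trans (exponent_succ_le_add hS hP hhi.le d)

/-- **Existence of the turning point**: `E ≤ S·P^E·(P − 1)` (`P^E > E`), so
`∃ a, E ≤ S·P^a·(P−1)`. [cite: NeukirchANT1999, Ch. II (5.5)] -/
theorem exists_le_increment (hS : 1 ≤ S) (hP : 2 ≤ P) (E : ℕ) :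
    ∃ a : ℕ, (E : ℤ) ≤ S * P ^ a * (P - 1) := by
  refine ⟨E, ?_⟩
  have h1 : (E : ℤ) < 2 ^ E := by exact_mod_cast Nat.lt_two_pow_self
  have h2 : (2 : ℤ) ^ E ≤ P ^ E := pow_le_pow_left₀ (by norm_num) hP E
  have h3 : 0 ≤ P ^ E := le_trans (by positivity) h2
  have h4 : P ^ E ≤ S * P ^ E := le_mul_of_one_le_left h3 hS
  have h5 : S * P ^ E ≤ S * P ^ E * (P - 1) :=
    le_mul_of_one_le_right (le_trans h3 h4) (by linarith)
  linarith

end Exponents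

/-! ### §2. The exponent of a general index: `N(p^a·m) = h(a) + s·p^a·(m − 1)` -/

section Index

variable {p : ℕ} [hp : Fact p.Prime]

/-- `v_p(p^a · m) = a` for `p ∤ m`. [cite: NeukirchANT1999, Ch. II (5.5)] -/
theorem padicValNat_prime_pow_mul {a m : ℕ} (hm : ¬ p ∣ m) : padicValNat p (p ^ a * m) = a := by
  have hm0 : m ≠ 0 := by rintro rfl; exact hm (dvd_zero p)
  rw [padicValNat.mul (pow_ne_zero _ hp.out.ne_zero) hm0, padicValNat.prime_pow,
    padicValNat.eq_zero_of_not_dvd hm, add_zero]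

/-- **Every index is controlled by a prime-power index**: for `n ≥ 1` there is `a` with
`h(a) ≤ N(n) := s·n − e·v_p(n)`, and `h(a) + 1 ≤ N(n)` unless `n = p^a` (`s ≥ 1`).
[cite: NeukirchANT1999, Ch. II (5.5)] -/
theorem exists_exponent_le_index {s : ℤ} (hs : 1 ≤ s) (e : ℕ) {n : ℕ} (hn : n ≠ 0) :
    ∃ a : ℕ, s * (p : ℤ) ^ a - e * (a : ℤ) ≤ s * (n : ℤ) - e * (padicValNat p n : ℤ) ∧
      (n ≠ p ^ a → s * (p : ℤ) ^ a - e * (a : ℤ) + 1 ≤ s * (n : ℤ) - e * (padicValNat p n : ℤ)) := by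
  obtain ⟨a, m, hm, rfl⟩ := Nat.exists_eq_pow_mul_and_not_dvd hn p hp.out.ne_one
  have hm1 : 1 ≤ m := Nat.one_le_iff_ne_zero.mpr (by rintro rfl; exact hm (dvd_zero p))
  have h1 : (1 : ℤ) ≤ (p : ℤ) ^ a := by exact_mod_cast Nat.one_le_pow _ _ hp.out.pos
  have hsp : 1 ≤ s * (p : ℤ) ^ a := one_le_mul_of_one_le_of_one_le hs h1
  have hkey : s * ((p ^ a * m : ℕ) : ℤ) = s * (p : ℤ) ^ a + s * (p : ℤ) ^ a * ((m : ℤ) - 1) := by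
    push_cast
    ring
  rw [padicValNat_prime_pow_mul hm, hkey]
  refine ⟨a, ?_, fun hne ↦ ?_⟩
  · have hm1' : (0 : ℤ) ≤ (m : ℤ) - 1 := by
      have : (1 : ℤ) ≤ m := by exact_mod_cast hm1
      linarith
    have h0 : 0 ≤ s * (p : ℤ) ^ a * ((m : ℤ) - 1) := mul_nonneg (by linarith) hm1'
    linarith
  · have hm2 : (1 : ℤ) ≤ (m : ℤ) - 1 := by
      have : m ≠ 1 := by rintro rfl; exact hne (mul_one _)
      have : (2 : ℤ) ≤ m := by exact_mod_cast (show 2 ≤ m by omega)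
      linarith
    have h0 : 1 ≤ s * (p : ℤ) ^ a * ((m : ℤ) - 1) := one_le_mul_of_one_le_of_one_le hsp hm2
    linarith

end Index

/-! ### §3. Norms of the terms over the discrete value group `‖ϖ‖^ℤ` -/

section Terms

variable (p : ℕ) [hp : Fact p.Prime]
variable {K : Type*} [NontriviallyNormedField K] [instK : NormedAlgebra ℚ_[p] K] [IsUltrametricDist K]
  [ProperSpace K]
variable {ϖ : Kˣ}

/-- `p = ‖ϖ‖^{−e}` as a real number (`‖p‖ = ‖ϖ‖^e = p⁻¹`). [cite: NeukirchANT1999, Ch. II (5.5)] -/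
theorem natCast_prime_eq_zpow (hϖ : IsUniformizer ϖ) :
    (p : ℝ) = ‖(ϖ : K)‖ ^ (-(absRamificationIdx p K : ℤ)) := by
  rw [zpow_neg, zpow_natCast, norm_pow_absRamificationIdx p K hϖ, inv_inv]

/-- `p^v = ‖ϖ‖^{−e·v}`. [cite: NeukirchANT1999, Ch. II (5.5)] -/
theorem natCast_prime_pow_eq_zpow (hϖ : IsUniformizer ϖ) (v : ℕ) :
    (p : ℝ) ^ v = ‖(ϖ : K)‖ ^ (-((absRamificationIdx p K : ℤ) * v)) := by
  rw [natCast_prime_eq_zpow p hϖ, ← zpow_natCast, ← zpow_mul, neg_mul]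

/-- **Norm of the `n`-th term**: if `‖1 − y‖ = ‖ϖ‖^s` then
`‖−(1−y)^{n+1}/(n+1)‖ = ‖ϖ‖^{s·(n+1) − e·v_p(n+1)}`. [cite: NeukirchANT1999, Ch. II (5.5)] -/
theorem norm_logTerm_eq_zpow (hϖ : IsUniformizer ϖ) {y : K} {s : ℤ} (hy : ‖1 - y‖ = ‖(ϖ : K)‖ ^ s)
    (n : ℕ) : ‖-((1 - y) ^ (n + 1)) / (n + 1 : K)‖ =
      ‖(ϖ : K)‖ ^ (s * ((n + 1 : ℕ) : ℤ) - (absRamificationIdx p K : ℤ) * (padicValNat p (n + 1) : ℤ)) := by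
  have hρ : ‖(ϖ : K)‖ ≠ 0 := (norm_units_pos ϖ).ne'
  rw [LogVolume.norm_logTerm_eq p K y n, hy, natCast_prime_pow_eq_zpow p hϖ, ← zpow_natCast,
    ← zpow_mul, ← zpow_add₀ hρ, ← sub_eq_add_neg]

/-- **All terms small**: if every exponent is `≥ 1` then `‖L(y)‖ ≤ ‖ϖ‖ (< 1)`.
[cite: NeukirchANT1999, Ch. II (5.5)] -/
theorem norm_logSeries_le_norm_unif (hϖ : IsUniformizer ϖ) {y : K} {s : ℤ}
    (hy : ‖1 - y‖ = ‖(ϖ : K)‖ ^ s)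
    (h : ∀ n : ℕ, 1 ≤ s * ((n + 1 : ℕ) : ℤ) - (absRamificationIdx p K : ℤ) * (padicValNat p (n + 1) : ℤ)) :
    ‖logSeries y‖ ≤ ‖(ϖ : K)‖ := by
  refine norm_logSeries_le (norm_nonneg _) fun n ↦ ?_
  rw [norm_logTerm_eq_zpow p hϖ hy n]
  calc ‖(ϖ : K)‖ ^ (s * ((n + 1 : ℕ) : ℤ) - (absRamificationIdx p K : ℤ) * (padicValNat p (n + 1) : ℤ))
      ≤ ‖(ϖ : K)‖ ^ (1 : ℤ) := zpow_le_zpow_right_of_le_one₀ (norm_units_pos ϖ) hϖ.1.le (h n)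
    _ = ‖(ϖ : K)‖ := zpow_one _

/-- **A unique dominant term decides the norm**: if the term of index `n₀ + 1` has exponent `N₀` and
every other term has exponent `≥ N₀ + 1`, then `‖L(y)‖ = ‖ϖ‖^{N₀}` (ultrametric isosceles principle;
`y` principal, so the series converges). [cite: NeukirchANT1999, Ch. II (5.5)] -/
theorem norm_logSeries_eq_zpow_of_dominant (hϖ : IsUniformizer ϖ) {y : K} (hyP : IsPrincipal y)
    {s : ℤ} (hy : ‖1 - y‖ = ‖(ϖ : K)‖ ^ s) (n₀ : ℕ) {N₀ : ℤ}
    (h₀ : s * ((n₀ + 1 : ℕ) : ℤ) - (absRamificationIdx p K : ℤ) * (padicValNat p (n₀ + 1) : ℤ) = N₀)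
    (h : ∀ n : ℕ, n ≠ n₀ →
      N₀ + 1 ≤ s * ((n + 1 : ℕ) : ℤ) - (absRamificationIdx p K : ℤ) * (padicValNat p (n + 1) : ℤ)) :
    ‖logSeries y‖ = ‖(ϖ : K)‖ ^ N₀ := by
  classical
  have hρ0 : 0 < ‖(ϖ : K)‖ := norm_units_pos ϖ
  set f : ℕ → K := fun n ↦ -((1 - y) ^ (n + 1)) / (n + 1 : K) with hf
  have hsum : HasSum f (logSeries y) := hasSum_logSeries p hyP
  have hsum' : HasSum (fun n ↦ if n = n₀ then 0 else f n) (logSeries y - f n₀) :=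
    hasSum_ite_sub_hasSum hsum n₀
  have hterm : ∀ n, ‖f n‖ = ‖(ϖ : K)‖ ^
      (s * ((n + 1 : ℕ) : ℤ) - (absRamificationIdx p K : ℤ) * (padicValNat p (n + 1) : ℤ)) :=
    fun n ↦ norm_logTerm_eq_zpow p hϖ hy n
  have hmain : ‖f n₀‖ = ‖(ϖ : K)‖ ^ N₀ := by rw [hterm n₀, h₀]
  have hrest : ‖logSeries y - f n₀‖ ≤ ‖(ϖ : K)‖ ^ (N₀ + 1) := by
    rw [← hsum'.tsum_eq]
    refine IsUltrametricDist.norm_tsum_le_of_forall_le_of_nonneg (zpow_pos hρ0 _).le fun n ↦ ?_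
    by_cases hn : n = n₀
    · rw [if_pos hn, norm_zero]; exact (zpow_pos hρ0 _).le
    · rw [if_neg hn, hterm n]
      exact zpow_le_zpow_right_of_le_one₀ hρ0 hϖ.1.le (h n hn)
  have hlt : ‖logSeries y - f n₀‖ < ‖f n₀‖ := by
    rw [hmain]
    exact hrest.trans_lt (zpow_lt_zpow_right_of_lt_one₀ hρ0 hϖ.1 (lt_add_one N₀))
  have hsplit : logSeries y = f n₀ + (logSeries y - f n₀) := by ring
  rw [hsplit, IsUltrametricDist.norm_add_eq_max_of_norm_ne_norm (ne_of_gt hlt), max_eq_left hlt.le,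
    hmain]

end Terms


end RamificationCriterion

end Literature.IUT.LogVolume

end
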